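import Summits.QuantumFields.YangMills.Theorems.FibreConvexityTailHistoryTailOfTwoSided

/-!
# Crux `HistoryTailL` (stmt-QuantumFields-19936), line #12 — THE p-LINEAR GLUE (B′):
# `HistoryTailL` ⟸ local finest-bad-level tails with an exponent LINEAR in Bałaban's `p(g)` (not quadratic)

Cell `ym3-torus` (YM ladder rung R3 = continuum SU(2) Yang–Mills on the 3-torus — NOT d = 4, NOT infinite volume, NOT a mass gap, NOT the Clay
problem), width seat `ym-ust-19936-w4` gen 12; `--supports stmt-QuantumFields-19936 --as helper`.  Companion of the located memo
`K1-MESOSCOPIC-LOCATE-w4g12.md` (19936 evidence #46) §2 «LOCATED RELAXATION»: the parent crux `UnitScaleTilt.HistoryTailL` only asks for a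
SUMMABLE profile (`T3UnitScaleTilt.HistoryTailAt`), so per-height tails `C·e^{−c·p(g_{K−j})}` — LINEAR in `p = b₀(1 + log g⁻¹)^{p₀}`, the shape an
EXPONENTIAL (Poincaré ∕ spectral-gap class) concentration inequality delivers at the window — suffice, exactly as the QUADRATIC shape
`C·β^A·e^{−c·p²}` of route FibreConvexityTail's `TwoSidedTailL`∕`TowerTailL` does (✓`fibreConvexityTail_historyTailOfTwoSided_proof`).

* §1 `perHeight_bound_lin` — the per-height arithmetic with a LINEAR exponent: for `b₀ ≥ 2(A+4)∕c`,
  `9·(8L^{3m}(L^i)³)·C·β_i^A·e^{−c·p(g_i)} ≤ (72·C·L^{3m}·γ^{−A})·2^{−i}` (`p(g_i) ≥ ½b₀·i·log L`, `log L ≥ log 2`; no completing of squares —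
  the threshold `bmin` absorbs the polynomial prefactor, which is why the p-linear statements below put `∃ C c bmin` BEFORE `∀ b₀ ≥ bmin`).
* §2 `real_finestBad_le_sum_local` — at one height the finest-bad-level event is covered by the per-plaquette events
  `{θ(K−j) ≤ dist1 Ū^{j}(∂a)} ∩ {all finer heights globally small}`.
* §3 ★★`historyTailL_of_linearTail (hT) : UnitScaleTilt.HistoryTailL` — from the p-LINEAR per-plaquette finest-bad-level tail
  `hT : ∀ L, ∃ bmin C c, 0 ≤ C ∧ 0 < c ∧ ∀ b₀ ≥ bmin, 0 < b₀ → ∀ p₀ > 2, ∃ γ₁ ∈ (0,1], ∀ F γ …, ∀ K j (1 ≤ j, j+2 ≤ K) a,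
  gibbsK({θ(K−j) ≤ dist1 Ū^{j}(∂a)} ∩ {∀ i < j, PlaqSmall θ(K−i) Ū^{i}}) ≤ C·exp(−c·p(g_{K−j}))`, via the SHAPE-AGNOSTIC reduction
  ✓`HistoryTailOfTwoSided.historyTailAt_of_bare_finestBad` (bare profile = the landed ✓`T3BareTailProfile.bareTailAt`).

HONEST: route glue (bookkeeping); the p-linear tail `hT` is OPEN (it is what line #12's induction would deliver from a Poincaré-class K1 —
the companion files `…LinearStep`∕`…LinearTail`); nothing of K1∕K2, the cruxes, rung R3 or the mass gap is proved here.  THEOREMS ONLY, def-free.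
[cite: Balaban1985UV3, (7) p.257 and (71) p.273]
-/

noncomputable section

open MeasureTheory Filter Topology
open Literature.MathematicalPhysics.QuantumFieldTheory.Balaban1983to89
open Literature.MathematicalPhysics.QuantumFieldTheory.Balaban1983to89.Missing
open Literature.MathematicalPhysics.QuantumFieldTheory.Balaban1983to89.T4Continuum
open Literature.MathematicalPhysics.QuantumFieldTheory.Balaban1983to89.T3ContinuumYM3Torus
open Literature.MathematicalPhysics.QuantumFieldTheory.Balaban1983to89.T3UnitScaleTilt
open Literature.MathematicalPhysics.QuantumFieldTheory.Balaban1983to89.T3UnitLawDensityEML (ℰp measurableE_ℰp)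
open Literature.MathematicalPhysics.QuantumFieldTheory.Balaban1983to89.T3BareTailProfile
open Summit.QuantumFields.YangMills.Theorems.HistoryTailOfTwoSided

namespace Summit.QuantumFields.YangMills.Theorems.PoincareLipschitzHistoryTailOfLinearTail

/-! ## §1 The per-height arithmetic with a linear exponent -/

/-- **PER-HEIGHT ARITHMETIC, p-LINEAR** (`0 < γ ≤ 1`, `0 < b₀`, `1 ≤ p₀`, `C ≥ 0`, `c > 0`, and the threshold `2(A+4) ≤ c·b₀`): at distance `i`
from the unit scale, `9·(8L^{3m}(L^i)³)·C·β_i^A·e^{−c·p(g_i)} ≤ (72·C·L^{3m}·γ^{−A})·2^{−i}` — since `p(g_i) ≥ b₀(1 + log g_i⁻¹) ≥ ½b₀·i·log L`,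
`β_i^A = γ^{−A}L^{iA}`, and `(3+A)·log L − ½c b₀·log L ≤ −log L ≤ −log 2`. [cite: Balaban1985UV3, (7) p.257 and (71) p.273] -/
theorem perHeight_bound_lin (F : T3Family) {γ b₀ p₀ : ℝ} (hγ : 0 < γ) (hγ1 : γ ≤ 1) (hb₀ : 0 < b₀) (hp₀ : 1 ≤ p₀)
    {C : ℝ} (hC : 0 ≤ C) (A : ℕ) {c : ℝ} (hc : 0 < c) (hb : 2 * ((A : ℝ) + 4) ≤ c * b₀) (i : ℕ) :
    (9 * (8 * (F.L : ℝ) ^ (3 * F.m) * ((F.L : ℝ) ^ i) ^ 3)) *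
        (C * (F.scheme ℰp γ).β i ^ A *
          Real.exp (-(c * B10.pFun b₀ p₀ (Real.sqrt (γ * ((F.L : ℝ)⁻¹) ^ i))))) ≤
      (72 * C * (F.L : ℝ) ^ (3 * F.m) * γ⁻¹ ^ A) * ((1 : ℝ) / 2) ^ i := by
  -- constants
  have hL2 : (2 : ℝ) ≤ F.L := by exact_mod_cast F.hL.2
  have hL1 : (1 : ℝ) < F.L := by linarith
  have hL0 : (0 : ℝ) < F.L := by linarith
  set ℓ : ℝ := Real.log F.L with hℓ
  have hℓ2 : Real.log 2 ≤ ℓ := Real.log_le_log two_pos hL2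
  have hℓ0 : 0 < ℓ := lt_of_lt_of_le (Real.log_pos one_lt_two) hℓ2
  have hlogγ : Real.log γ ≤ 0 := Real.log_nonpos hγ.le hγ1
  -- the coupling at distance `i`
  set x : ℝ := γ * ((F.L : ℝ)⁻¹) ^ i with hx
  have hLK0 : (0 : ℝ) < (F.L : ℝ) ^ i := pow_pos hL0 i
  have hinvK : ((F.L : ℝ)⁻¹) ^ i = ((F.L : ℝ) ^ i)⁻¹ := by rw [inv_pow]
  have hx0 : 0 < x := by rw [hx, hinvK]; positivity
  have hxinv : x⁻¹ = γ⁻¹ * (F.L : ℝ) ^ i := by rw [hx, hinvK, mul_inv, inv_inv]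
  set g : ℝ := Real.sqrt x with hg
  have hg0 : 0 < g := Real.sqrt_pos.mpr hx0
  have hlogg : Real.log g⁻¹ = (i * ℓ - Real.log γ) / 2 := by
    rw [Real.log_inv, hg, Real.log_sqrt hx0.le, hx, Real.log_mul hγ.ne' (pow_ne_zero _ (inv_ne_zero hL0.ne')),
      Real.log_pow, Real.log_inv]
    ring
  set u : ℝ := 1 + Real.log g⁻¹ with hu
  have hu1 : 1 ≤ u := by
    rw [hu, hlogg]
    have : 0 ≤ (i : ℝ) * ℓ := by positivity
    linarith
  have huK : (i : ℝ) * ℓ / 2 ≤ u := by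
    rw [hu, hlogg]; linarith
  -- `p(g_i) ≥ ½ b₀ i log L`
  have hpF : B10.pFun b₀ p₀ g = b₀ * u ^ p₀ := rfl
  have hup : u ≤ u ^ p₀ := Real.self_le_rpow_of_one_le hu1 hp₀
  have hpF_ge : b₀ * ((i : ℝ) * ℓ / 2) ≤ B10.pFun b₀ p₀ g := by
    rw [hpF]
    calc b₀ * ((i : ℝ) * ℓ / 2) ≤ b₀ * u := by gcongr
      _ ≤ b₀ * u ^ p₀ := by gcongr
  -- the exponential factor against the polynomial growth: `(3+A)·iℓ − c·p ≤ −iℓ ≤ −i log 2`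
  have hexp : ((F.L : ℝ) ^ i) ^ 3 * ((F.L : ℝ) ^ i) ^ A * Real.exp (-(c * B10.pFun b₀ p₀ g)) ≤ ((1 : ℝ) / 2) ^ i := by
    have hLpow : ((F.L : ℝ) ^ i) ^ 3 * ((F.L : ℝ) ^ i) ^ A = Real.exp ((3 + A) * ((i : ℝ) * ℓ)) := by
      rw [← pow_add, ← pow_mul, hℓ, show ((3 : ℝ) + A) * ((i : ℝ) * Real.log F.L) = ((i * (3 + A) : ℕ) : ℝ) * Real.log F.L by
        push_cast; ring, Real.exp_nat_mul, Real.exp_log hL0]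
    have hhalf : ((1 : ℝ) / 2) ^ i = Real.exp (-((i : ℝ) * Real.log 2)) := by
      rw [Real.exp_neg, Real.exp_nat_mul, Real.exp_log two_pos, one_div, inv_pow]
    rw [hLpow, hhalf, ← Real.exp_add]
    refine Real.exp_le_exp.mpr ?_
    have h1 : c * (b₀ * ((i : ℝ) * ℓ / 2)) ≤ c * B10.pFun b₀ p₀ g := mul_le_mul_of_nonneg_left hpF_ge hc.le
    have hi0 : (0 : ℝ) ≤ (i : ℝ) := Nat.cast_nonneg i
    -- `(3+A) iℓ − (c b₀∕2) iℓ ≤ −iℓ ≤ −i log 2`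
    have h2 : ((3 : ℝ) + A) * ((i : ℝ) * ℓ) - c * (b₀ * ((i : ℝ) * ℓ / 2)) ≤ -((i : ℝ) * ℓ) := by
      have : ((3 : ℝ) + A + 1) * ((i : ℝ) * ℓ) ≤ c * b₀ / 2 * ((i : ℝ) * ℓ) :=
        mul_le_mul_of_nonneg_right (by linarith) (by positivity)
      linarith
    have h3 : -((i : ℝ) * ℓ) ≤ -((i : ℝ) * Real.log 2) := by nlinarith
    linarith
  -- the inverse coupling factor `β_i^A = γ^{−A} (L^i)^A`
  have hβA : (F.scheme ℰp γ).β i ^ A = γ⁻¹ ^ A * ((F.L : ℝ) ^ i) ^ A := by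
    rw [show (F.scheme ℰp γ).β i = (γ * ((F.L : ℝ)⁻¹) ^ i)⁻¹ from rfl, ← hx, hxinv, mul_pow]
  -- assemble
  rw [hβA]
  calc (9 * (8 * (F.L : ℝ) ^ (3 * F.m) * ((F.L : ℝ) ^ i) ^ 3)) *
        (C * (γ⁻¹ ^ A * ((F.L : ℝ) ^ i) ^ A) * Real.exp (-(c * B10.pFun b₀ p₀ g)))
      = (72 * C * (F.L : ℝ) ^ (3 * F.m) * γ⁻¹ ^ A) *
          (((F.L : ℝ) ^ i) ^ 3 * ((F.L : ℝ) ^ i) ^ A * Real.exp (-(c * B10.pFun b₀ p₀ g))) := by ring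
    _ ≤ (72 * C * (F.L : ℝ) ^ (3 * F.m) * γ⁻¹ ^ A) * ((1 : ℝ) / 2) ^ i := by
        gcongr

/-! ## §2 One height: the finest-bad-level event is covered by the per-plaquette events -/

/-- At one height, for a finite measure `μ`, any map `Φ` to height-`j` fields and any event `B`:
`μ({¬PlaqSmall θ (Φ y)} ∩ B) ≤ Σ_a μ({θ ≤ dist1((Φ y)(∂a))} ∩ B)` (union bound over plaquettes). [folklore] -/
theorem real_not_plaqSmall_inter_le_sum {Y : Type*} [MeasurableSpace Y] (μ : Measure Y) [IsFiniteMeasure μ]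
    {G : Type*} [GaugeGroup G] {P : Params} {j : ℕ} (Φ : Y → GaugeField P j G) (θ : ℝ) (B : Set Y) :
    μ.real ({y | ¬ PlaqSmall θ (Φ y)} ∩ B) ≤
      ∑ a : Plaq P j, μ.real ({y | θ ≤ GaugeGroup.dist1 (GaugeField.plaqHol (Φ y) a)} ∩ B) := by
  have hset : {y | ¬ PlaqSmall θ (Φ y)} ∩ B ⊆
      ⋃ a : Plaq P j, ({y | θ ≤ GaugeGroup.dist1 (GaugeField.plaqHol (Φ y) a)} ∩ B) := by
    intro y hy
    obtain ⟨h1, h2⟩ := hy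
    simp only [PlaqSmall, Set.mem_setOf_eq, not_forall, not_lt] at h1
    obtain ⟨a, ha⟩ := h1
    exact Set.mem_iUnion.mpr ⟨a, ha, h2⟩
  exact (measureReal_mono hset (measure_ne_top _ _)).trans (measureReal_iUnion_fintype_le _)

/-! ## §3 `HistoryTailL` from p-linear finest-bad-level tails -/

/-- ★★ **`UnitScaleTilt.HistoryTailL` FROM p-LINEAR PER-PLAQUETTE FINEST-BAD-LEVEL TAILS.**  Suppose that for every block size `L` there are
`bmin`, `C ≥ 0`, `c > 0` such that for all `b₀ ≥ bmin`, `b₀ > 0`, `p₀ > 2` some `γ₁ ∈ (0,1]` makes, for every family `F` with `F.L = L`, every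
`0 < γ ≤ γ₁`, all `1 ≤ j`, `j + 2 ≤ K` and every height-`j` plaquette `a`,
`Gibbs_K({θ(K−j) ≤ dist1(Ū^{j}(∂a))} ∩ {∀ i < j, PlaqSmall θ(K−i) (Ū^{i})}) ≤ C·exp(−c·p(g_{K−j}))` — exponent LINEAR in
`p(g) = b₀(1 + log g⁻¹)^{p₀}` (the Poincaré ∕ exponential-concentration shape), `C, c, bmin` depending on `L` only.  THEN the parent crux's body
holds: for every `L` and floor `(b₁, p₁)` the profile `b₀ = max b₁ (max bmin (max (16∕c) 1))`, `p₀ = max p₁ 3` and, for each `m ≥ 1`, the supplier's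
`γ₁` give `HistoryTailAt F γ b₀ p₀ m`.  Proof: the shape-agnostic reduction ✓`historyTailAt_of_bare_finestBad` with the landed bare profile
✓`bareTailAt`, the plaquette union bound (§2), ✓`card_plaq_le_pow` and the p-linear per-height arithmetic (§1, `A = 0`, threshold `8 ≤ c·b₀`).
Route glue only; `hT` is NOT proved. [cite: Balaban1985UV3, (7) p.257 and (71) p.273] -/
theorem historyTailL_of_linearTail
    (hT : ∀ (L : ℕ), ∃ (bmin C c : ℝ), 0 ≤ C ∧ 0 < c ∧ ∀ (b₀ p₀ : ℝ), bmin ≤ b₀ → 0 < b₀ → 2 < p₀ →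
      ∃ γ₁ : ℝ, 0 < γ₁ ∧ γ₁ ≤ 1 ∧ ∀ (F : T3Family) (γ : ℝ), F.L = L → 0 < γ → γ ≤ γ₁ →
        ∀ (K j : ℕ), 1 ≤ j → j + 2 ≤ K → ∀ a : Plaq (F.P K) j,
          (gibbsK F ℰp γ K).real
              ({U : GaugeField (F.P K) 0 (Matrix.specialUnitaryGroup (Fin 2) ℂ) |
                  θBal F.L γ b₀ p₀ (K - j) ≤ GaugeGroup.dist1 (GaugeField.plaqHol
                    (Averaging.iter (fun i' => BlockAveraging.blockAvg (P := F.P K) (j := i') ℰp) j U) a)} ∩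
                {U : GaugeField (F.P K) 0 (Matrix.specialUnitaryGroup (Fin 2) ℂ) | ∀ i, i < j →
                  PlaqSmall (θBal F.L γ b₀ p₀ (K - i))
                    (Averaging.iter (fun i' => BlockAveraging.blockAvg (P := F.P K) (j := i') ℰp) i U)}) ≤
            C * Real.exp (-(c * B10.pFun b₀ p₀ (Real.sqrt (γ * ((F.L : ℝ)⁻¹) ^ (K - j)))))) :
    Summit.QuantumFields.YangMills.Theses.UnitScaleTilt.HistoryTailL := by
  intro L b₁ p₁
  obtain ⟨bmin, C, c, hC, hc, H⟩ := hT L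
  -- the profile above the floor, above the supplier's threshold and above the arithmetic threshold `8 ≤ c·b₀`
  obtain ⟨b₀, hb₁, hbmin, hbc, hb₀1⟩ : ∃ b₀ : ℝ, b₁ ≤ b₀ ∧ bmin ≤ b₀ ∧ 16 / c ≤ b₀ ∧ 1 ≤ b₀ :=
    ⟨max b₁ (max bmin (max (16 / c) 1)), le_max_left _ _, le_max_of_le_right (le_max_left _ _),
      le_max_of_le_right (le_max_of_le_right (le_max_left _ _)),
      le_max_of_le_right (le_max_of_le_right (le_max_right _ _))⟩
  obtain ⟨p₀, hp₁, hp₀⟩ : ∃ p₀ : ℝ, p₁ ≤ p₀ ∧ 2 < p₀ :=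
    ⟨max p₁ 3, le_max_left _ _, lt_of_lt_of_le (by norm_num) (le_max_right _ _)⟩
  have hb₀ : 0 < b₀ := one_pos.trans_le hb₀1
  have hp₀1 : 1 ≤ p₀ := by linarith
  have hcb : 2 * (((0 : ℕ) : ℝ) + 4) ≤ c * b₀ := by
    have h1 : 16 / c * c ≤ b₀ * c := mul_le_mul_of_nonneg_right hbc hc.le
    rw [div_mul_cancel₀ _ hc.ne'] at h1
    push_cast; linarith
  refine ⟨b₀, p₀, hb₁, hp₁, hb₀, hp₀, fun m hm => ?_⟩
  obtain ⟨γ₁, hγ₁, hγ₁1, HF⟩ := H b₀ p₀ hbmin hb₀ hp₀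
  refine ⟨γ₁, hγ₁, fun F γ hFL hγ hγle => ?_⟩
  have hγ1 : γ ≤ 1 := hγle.trans hγ₁1
  -- the bare profile (landed: reflection positivity + chessboard) and the per-height constant
  obtain ⟨q₀, hq₀0, hq₀, -, hbare⟩ := bareTailAt F hγ hγ1 hb₀ hp₀1
  set A' : ℝ := 72 * C * (F.L : ℝ) ^ (3 * F.m) with hA'
  have hA'0 : 0 ≤ A' := by positivity
  obtain ⟨hq0, hq, hqt⟩ := geometric_profile hA'0
  refine historyTailAt_of_bare_finestBad F hγ.le b₀ p₀ hm q₀ (fun i => A' * ((1 : ℝ) / 2) ^ i)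
    hq₀0 hq₀ hq0 hq hqt hbare fun K j hj1 hjK => ?_
  -- one height `1 ≤ j`, `j + 2 ≤ K`: union over plaquettes, the p-linear tail, the count, the arithmetic
  haveI := isProbabilityMeasure_gibbsK F ℰp hγ.le K
  refine (real_not_plaqSmall_inter_le_sum (gibbsK F ℰp γ K)
    (Averaging.iter (fun i' => BlockAveraging.blockAvg (P := F.P K) (j := i') ℰp) j) (θBal F.L γ b₀ p₀ (K - j))
    {U | ∀ i, i < j → PlaqSmall (θBal F.L γ b₀ p₀ (K - i))
      (Averaging.iter (fun i' => BlockAveraging.blockAvg (P := F.P K) (j := i') ℰp) i U)}).trans ?_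
  refine (Finset.sum_le_sum fun a _ => HF F γ hFL hγ hγle K j hj1 hjK a).trans ?_
  rw [Finset.sum_const, Finset.card_univ, nsmul_eq_mul]
  have hcard := card_plaq_le_pow F (show j ≤ K by omega)
  have hX : 0 ≤ C * Real.exp (-(c * B10.pFun b₀ p₀ (Real.sqrt (γ * ((F.L : ℝ)⁻¹) ^ (K - j))))) := by positivity
  have hper := perHeight_bound_lin F hγ hγ1 hb₀ hp₀1 hC 0 hc hcb (K - j)
  simp only [pow_zero, mul_one] at hper
  calc (Fintype.card (Plaq (F.P K) j) : ℝ) * (C * Real.exp (-(c * B10.pFun b₀ p₀ (Real.sqrt (γ * ((F.L : ℝ)⁻¹) ^ (K - j))))))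
      ≤ (9 * (8 * (F.L : ℝ) ^ (3 * F.m) * ((F.L : ℝ) ^ (K - j)) ^ 3)) *
          (C * Real.exp (-(c * B10.pFun b₀ p₀ (Real.sqrt (γ * ((F.L : ℝ)⁻¹) ^ (K - j)))))) :=
        mul_le_mul_of_nonneg_right hcard hX
    _ ≤ A' * ((1 : ℝ) / 2) ^ (K - j) := by rw [hA']; exact hper

end Summit.QuantumFields.YangMills.Theorems.PoincareLipschitzHistoryTailOfLinearTail

end
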